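import Summits.Ventures.Crystal3D.Theorems.StickyWulffConstantPolycrystalWulffBoundDichotomyArith2
import Mathlib.Analysis.Convex.SpecificFunctions.Pow

/-!
# `PolycrystalWulffBound`: arithmetic of the DOMINANT-CLASS corner (line `PolyDensity`)

Route `StickyWulffConstant` of the venture `Summits/Ventures/Crystal3D`, crux `PolycrystalWulffBound`
(item `stmt-Ventures-19482`), second prover lane (poly-p2, gen 3).  Companion of `…DichotomyArith.lean`
/ `…DichotomyArith2.lean` (Mathlib-only import cone).  The seat's strategy «grain-count dichotomy»
has a MANY-GRAINS half (the fine corners, landed: classes `≤ Vol/3`) and a DOMINANT-GRAIN half: one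
lattice class `D` carries all but a fraction `η ≤ 3/20` of the volume.  For twin-free polyhedral
textures the dominant half closes with the crude tension bracket `√3 ≤ h_W ≤ √5` alone (no
quantitative Wulff inequality): writing `V = v_D + s` (`s` = satellite volume), `Y` = exterior area
of the satellites, `A` = wall area between `D` and the satellites,

* (recolouring bound)  `En ≥ w(V) − (√5 − √3)·Y + A` — paint the satellites with `D`'s Wulff body:
  the Wulff inequality for the whole set `E` with body `W_D`, the satellites' free energy is at least
  `√3·Y ≥ (h_{W_D} − (√5 − √3))·Y`, generic walls charged `≥ 1`;
* (per-class bound)    `En ≥ w(v_D) − √5·A + √3·Y + A` — one-grain Wulff for the merged class `D`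
  with wall over-count `ι_W ≤ √5·ι_B`, satellites' free energy `≥ √3·Y`;
* (isoperimetry of the satellites)  `Y + A ≥ c·s^{2/3}`, `c³ ≥ 36π`,

where `w(v) = 6·2^{1/3}(√2 v)^{2/3}`.  `dominant_arith`: these give `w(V) ≤ En` whenever
`s ≤ (3/20)·V` (weights `0.664 / 0.336`; the structure-free LP ceiling of the pair of bounds is
`≈ 0.16`).  The one real-analysis input is `rpow_two_thirds_dominant`:
`V^{2/3} ≤ (V − s)^{2/3} + 0.37·s^{2/3}` for `0 ≤ s ≤ (3/20)V` (concavity of `t ↦ t^{2/3}`,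
`Real.concaveOn_rpow`, and `(17/20)^{2/3} + 0.37·(3/20)^{2/3} ≥ 1.0017`).
WHAT THIS IS NOT: any statement about sets or perimeters; nothing on the crux beyond this corner.
-/

noncomputable section

namespace Summit.Ventures.Crystal3D.Theorems

open Real Finset

/-- `(17/20)^{2/3} ≥ 0.8973`. -/
theorem rpow_seventeen_twentieths_lower : (0.8973 : ℝ) ≤ (17 / 20 : ℝ) ^ ((2 : ℝ) / 3) := by
  set r : ℝ := (17 / 20 : ℝ) ^ ((2 : ℝ) / 3) with hr
  have hr0 : 0 ≤ r := by positivity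
  have hr3 : r ^ 3 = (17 / 20 : ℝ) ^ 2 := by
    rw [hr, ← Real.rpow_mul_natCast (by norm_num), ← Real.rpow_natCast _ 2]; norm_num
  by_contra h
  rw [not_le] at h
  have h3 : r ^ 3 < (0.8973 : ℝ) ^ 3 := by gcongr
  rw [hr3] at h3
  norm_num at h3

/-- `(3/20)^{2/3} ≥ 0.2823`. -/
theorem rpow_three_twentieths_lower : (0.2823 : ℝ) ≤ (3 / 20 : ℝ) ^ ((2 : ℝ) / 3) := by
  set r : ℝ := (3 / 20 : ℝ) ^ ((2 : ℝ) / 3) with hr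
  have hr0 : 0 ≤ r := by positivity
  have hr3 : r ^ 3 = (3 / 20 : ℝ) ^ 2 := by
    rw [hr, ← Real.rpow_mul_natCast (by norm_num), ← Real.rpow_natCast _ 2]; norm_num
  by_contra h
  rw [not_le] at h
  have h3 : r ^ 3 < (0.2823 : ℝ) ^ 3 := by gcongr
  rw [hr3] at h3
  norm_num at h3

/-- **The concavity step of the dominant corner.**  For `0 ≤ s ≤ (3/20)·V`:
`V^{2/3} ≤ (V − s)^{2/3} + 0.37·s^{2/3}` (both `t ↦ (V − t)^{2/3}` and `t ↦ t^{2/3}` are concave, and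
the inequality holds at the endpoint `s = (3/20)V` by `(17/20)^{2/3} + 0.37·(3/20)^{2/3} ≥ 1`). -/
theorem rpow_two_thirds_dominant {V s : ℝ} (hV : 0 ≤ V) (hs0 : 0 ≤ s) (hs : s ≤ 3 / 20 * V) :
    V ^ ((2 : ℝ) / 3) ≤ (V - s) ^ ((2 : ℝ) / 3) + 0.37 * s ^ ((2 : ℝ) / 3) := by
  rcases hV.eq_or_lt with hV0 | hVpos
  · -- `V = 0`, hence `s = 0`
    have hs00 : s = 0 := le_antisymm (by rw [← hV0] at hs; linarith) hs0
    rw [← hV0, hs00, sub_zero, Real.zero_rpow (by norm_num)]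
    norm_num
  -- `θ = s / ((3/20) V) ∈ [0, 1]`
  set θ : ℝ := s / (3 / 20 * V) with hθ
  have hden : 0 < 3 / 20 * V := by positivity
  have hθ0 : 0 ≤ θ := div_nonneg hs0 hden.le
  have hθ1 : θ ≤ 1 := (div_le_one hden).2 hs
  have hθs : θ * (3 / 20 * V) = s := div_mul_cancel₀ s hden.ne'
  have hconc := (Real.concaveOn_rpow (p := (2 : ℝ) / 3) (by norm_num) (by norm_num)).2
  -- concavity of `t^{2/3}` between `(17/20)V` and `V`, resp. between `(3/20)V` and `0`
  have hA : θ * ((17 / 20 * V) ^ ((2 : ℝ) / 3)) + (1 - θ) * V ^ ((2 : ℝ) / 3) ≤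
      (V - s) ^ ((2 : ℝ) / 3) := by
    have h := hconc (Set.mem_Ici.2 (by positivity : (0 : ℝ) ≤ 17 / 20 * V)) (Set.mem_Ici.2 hV) hθ0
      (sub_nonneg.2 hθ1) (by ring)
    simp only [smul_eq_mul] at h
    have heq : θ * (17 / 20 * V) + (1 - θ) * V = V - s := by rw [← hθs]; ring
    rw [heq] at h
    exact h
  have hB : θ * ((3 / 20 * V) ^ ((2 : ℝ) / 3)) ≤ s ^ ((2 : ℝ) / 3) := by
    have h := hconc (Set.mem_Ici.2 hden.le) (Set.mem_Ici.2 (le_refl (0 : ℝ))) hθ0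
      (sub_nonneg.2 hθ1) (by ring)
    simp only [smul_eq_mul, mul_zero, add_zero, Real.zero_rpow (by norm_num : (2 : ℝ) / 3 ≠ 0)] at h
    rw [hθs] at h
    exact h
  -- the endpoint inequality
  have h17 := rpow_seventeen_twentieths_lower
  have h3 := rpow_three_twentieths_lower
  have hW0 : 0 ≤ V ^ ((2 : ℝ) / 3) := by positivity
  have e17 : (17 / 20 * V) ^ ((2 : ℝ) / 3) = (17 / 20 : ℝ) ^ ((2 : ℝ) / 3) * V ^ ((2 : ℝ) / 3) :=
    Real.mul_rpow (by norm_num) hV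
  have e3 : (3 / 20 * V) ^ ((2 : ℝ) / 3) = (3 / 20 : ℝ) ^ ((2 : ℝ) / 3) * V ^ ((2 : ℝ) / 3) :=
    Real.mul_rpow (by norm_num) hV
  rw [e17] at hA
  rw [e3] at hB
  have hend : V ^ ((2 : ℝ) / 3) ≤ ((17 / 20 : ℝ) ^ ((2 : ℝ) / 3)) * V ^ ((2 : ℝ) / 3) +
      0.37 * (((3 / 20 : ℝ) ^ ((2 : ℝ) / 3)) * V ^ ((2 : ℝ) / 3)) := by
    nlinarith [mul_le_mul_of_nonneg_right h17 hW0, mul_le_mul_of_nonneg_right h3 hW0]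
  nlinarith [mul_le_mul_of_nonneg_left hend hθ0, hA, hB, hW0, hθ0, hθ1,
    mul_nonneg hθ0 (mul_nonneg (le_trans (by norm_num) h3) hW0)]

/-- **Dominant-class corner (arithmetic of `rung_dominantTwinFree`).**  Let `c > 0` with `c³ ≥ 36π`,
volumes `V = v_D + s` with `v_D, s ≥ 0` and `s ≤ (3/20)·V`, nonnegative areas `Y, A` with
`c·s^{2/3} ≤ Y + A` (isoperimetry of the satellites), and an energy `En` with
`w(V) − (√5 − √3)·Y + A ≤ En` (recolouring bound) and `w(v_D) + √3·Y − (√5 − 1)·A ≤ En` (per-class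
bound), `w(v) = 6·2^{1/3}(√2 v)^{2/3}`.  Then `w(V) ≤ En`. -/
theorem dominant_arith {c V vD s Y A En : ℝ} (hc : 0 < c) (hc3 : 36 * Real.pi ≤ c ^ 3)
    (hvD : 0 ≤ vD) (hs0 : 0 ≤ s) (hV : V = vD + s) (hsmall : s ≤ 3 / 20 * V)
    (hY : 0 ≤ Y) (hA : 0 ≤ A) (hiso : c * s ^ ((2 : ℝ) / 3) ≤ Y + A)
    (h1 : 6 * (2 : ℝ) ^ ((1 : ℝ) / 3) * (Real.sqrt 2 * V) ^ ((2 : ℝ) / 3) -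
      (Real.sqrt 5 - Real.sqrt 3) * Y + A ≤ En)
    (h2 : 6 * (2 : ℝ) ^ ((1 : ℝ) / 3) * (Real.sqrt 2 * vD) ^ ((2 : ℝ) / 3) +
      Real.sqrt 3 * Y - (Real.sqrt 5 - 1) * A ≤ En) :
    6 * (2 : ℝ) ^ ((1 : ℝ) / 3) * (Real.sqrt 2 * V) ^ ((2 : ℝ) / 3) ≤ En := by
  have hV0 : 0 ≤ V := by rw [hV]; positivity
  rw [wulffConstant_eq' hV0] at h1 ⊢
  rw [wulffConstant_eq' hvD] at h2
  obtain ⟨ht1, ht2, -⟩ := cbrt_two_bounds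
  set t : ℝ := (2 : ℝ) ^ ((1 : ℝ) / 3) with ht
  have ht0 : 0 ≤ t := by positivity
  -- the concavity step
  have hkey := rpow_two_thirds_dominant hV0 hs0 hsmall
  have hVs : V - s = vD := by rw [hV]; ring
  rw [hVs] at hkey
  set W : ℝ := V ^ ((2 : ℝ) / 3) with hW
  set WD : ℝ := vD ^ ((2 : ℝ) / 3) with hWD
  set Z : ℝ := s ^ ((2 : ℝ) / 3) with hZ
  have hW0 : 0 ≤ W := by positivity
  have hWD0 : 0 ≤ WD := by positivity
  have hZ0 : 0 ≤ Z := by positivity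
  -- decimal brackets
  have h3 : (1.732 : ℝ) ≤ Real.sqrt 3 := sqrt_three_lower
  have h5 : Real.sqrt 5 ≤ (2.2361 : ℝ) := sqrt_five_upper
  have hc1 : (4.835 : ℝ) ≤ c := isoConst_lower hc hc3
  have ht2u : t ^ 2 ≤ (1.25993 : ℝ) ^ 2 := by gcongr
  -- products, as linear facts
  have p1 : (Real.sqrt 5 - Real.sqrt 3) * Y ≤ (2.2361 - 1.732) * Y :=
    mul_le_mul_of_nonneg_right (by linarith) hY
  have p2 : (Real.sqrt 5 - 1) * A ≤ (2.2361 - 1) * A := mul_le_mul_of_nonneg_right (by linarith) hA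
  have p3 : (1.732 : ℝ) * Y ≤ Real.sqrt 3 * Y := mul_le_mul_of_nonneg_right h3 hY
  have p4 : (4.835 : ℝ) * Z ≤ c * Z := mul_le_mul_of_nonneg_right hc1 hZ0
  have p5 : t ^ 2 * (W - WD) ≤ (1.25993 : ℝ) ^ 2 * (0.37 * Z) := by
    calc t ^ 2 * (W - WD) ≤ t ^ 2 * (0.37 * Z) := mul_le_mul_of_nonneg_left (by linarith) (sq_nonneg t)
      _ ≤ (1.25993 : ℝ) ^ 2 * (0.37 * Z) := mul_le_mul_of_nonneg_right ht2u (by positivity)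
  nlinarith [p1, p2, p3, p4, p5, hiso, h1, h2, hY, hA, hZ0, hW0, hWD0, sq_nonneg t]

end Summit.Ventures.Crystal3D.Theorems

end
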